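import Mathlib
import Summits.ValiantsHypothesis.ValiantsHypothesis.Theorems.RigidityForcesSymmetryRankRigidMinimalReprLaplaceTriangular

/-!
# The triangular witness lemma with one basis row (functional dual of `LaplaceOptimal`)
# (crux `RankRigidMinimalRepr`, stmt-ValiantsHypothesis-18034; frontier rung `LaplaceOptimalFive`, stmt-24813)

Variant of `LaplaceTriangular.triangular_witness` for configurations WITHOUT a slice-free slot outside the pair cut
(at `n = 5`: the two `a = 4` configurations «one slice at each of four slots, pair through the fifth» and «slices
2+1+1, pair on the two other slots»).  The slot `f = ord 0` processed first must be slice-free and cannot be the LATER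
pair endpoint `q` (it may be `p`); its covector is the BASIS ROW `e_{c₀}`.  A later row must avoid the pivots of the
earlier later rows, and needs a pivot `≠ c₀`; it need NOT vanish at `c₀` (the basis row pins the column `c₀` in the
permanent).  A pivot `≠ c₀` is automatic for a slot owning a slice vector `β` with `β(c₀) ≠ 0` (a non-zero solution of
its constraints is then not a multiple of `e_{c₀}`) and costs the extra condition `ψ(c₀) = 0` otherwise.  Hence the
COUNT hypothesis at position `j ≥ 1` (slot `s`): `|A_s| + [s = q] + j ≤ n - 1`, relaxed to `≤ n` at slots with such a
`β` («bonus»; choose `c₀` in the support of a slice vector to earn it).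

* `permanent_eq_prod_of_triangular_basis` — permanent of a matrix with one basis row, the other rows triangular;
* `triangular_witness_basis` — the greedy construction.

General `n`; no new definitions.  HONEST FRAMING: infrastructure for the frontier rung `LaplaceOptimalFive`
(stmt-24813), which stays OPEN; nothing here bears on `VP ≠ VNP`.
-/

set_option autoImplicit false

-- the mandated summit-side namespace repeats a component by design (single-problem summit)
set_option linter.dupNamespace false

namespace Summit.ValiantsHypothesis.ValiantsHypothesis.Theorems.RigidityForcesSymmetryRankRigidMinimalRepr

namespace LaplaceTriangular

open Finset Module

variable {n : ℕ}

/-! ### §1 The permanent with one basis row -/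

/-- **Triangular permanent with a basis row.**  Row `f` vanishes off its pivot `τ f`; among the other rows,
`φ_i(τ i') = 0` whenever `pos i' < pos i` (`pos` injective).  Then `per (φ_i(c))_{c,i} = Π_i φ_i(τ i)` — the values
of the other rows at `τ f` are irrelevant. -/
theorem permanent_eq_prod_of_triangular_basis (φ : Fin n → Fin n → ℂ) (τ : Equiv.Perm (Fin n)) (pos : Fin n → ℕ)
    (hpos : Function.Injective pos) (f : Fin n) (hf : ∀ x, x ≠ τ f → φ f x = 0)
    (htri : ∀ i i', i ≠ f → i' ≠ f → pos i' < pos i → φ i (τ i') = 0) :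
    (Matrix.of fun c i => φ i c).permanent = ∏ i, φ i (τ i) := by
  classical
  unfold Matrix.permanent
  rw [sum_eq_single τ]
  · simp [Matrix.of_apply]
  · intro σ _ hστ
    simp only [Matrix.of_apply]
    set π : Equiv.Perm (Fin n) := σ.trans τ.symm with hπ
    have hτπ : ∀ i, τ (π i) = σ i := fun i => by simp [hπ]
    by_contra hprod
    have hall : ∀ i, φ i (σ i) ≠ 0 := fun i h => hprod (prod_eq_zero (mem_univ i) h)
    have hσf : σ f = τ f := by
      by_contra h; exact hall f (hf (σ f) h)
    have hπf : π f = f := by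
      apply τ.injective; rw [hτπ, hσf]
    have hπne : ∀ i, i ≠ f → π i ≠ f := fun i hi h => hi (π.injective (h.trans hπf.symm))
    have hge : ∀ i ∈ (univ : Finset (Fin n)), pos i ≤ pos (π i) := by
      intro i _
      by_cases hi : i = f
      · rw [hi, hπf]
      · by_contra hlt
        push Not at hlt
        have := htri i (π i) hi (hπne i hi) hlt
        rw [hτπ] at this
        exact hall i this
    have hsum : ∑ i, pos (π i) = ∑ i, pos i := Equiv.sum_comp π pos
    have heq := (sum_eq_sum_iff_of_le hge).mp hsum.symm
    apply hστ
    ext i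
    have h1 : i = π i := hpos (heq i (mem_univ i))
    have h2 := hτπ i
    rw [← h1] at h2
    exact congrArg Fin.val h2.symm
  · intro h; exact absurd (mem_univ τ) h

/-! ### §2 The greedy construction with a basis row first -/

/-- **Triangular witness lemma, basis-row variant.**  `n ≥ 1`; slots in the order `ord`; the first slot
`f = ord 0` has no slice and is not the later pair endpoint (`p` precedes `q` in `ord`); its row is the basis row
`e_{c₀}`.  COUNT at every position `j ≥ 1` (slot `s = ord j`): either `|A s| + [s = q] + j ≤ n - 1`, or
`|A s| + [s = q] + j ≤ n` together with a slice vector `β ∈ A s` with `β(c₀) ≠ 0`.  Then some covector tuple kills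
every slice and the pair and has non-zero permanent. -/
theorem triangular_witness_basis (hn : 0 < n) (ord : Equiv.Perm (Fin n)) (A : Fin n → Finset (Fin n → ℂ))
    (p q : Fin n) (hpq : ord.symm p < ord.symm q) (g : Fin n → Fin n → ℂ) (c₀ : Fin n)
    (hA0 : A (ord ⟨0, hn⟩) = ∅)
    (hcount : ∀ j : Fin n, 0 < (j : ℕ) →
      (A (ord j)).card + (if ord j = q then 1 else 0) + (j : ℕ) + 1 ≤ n ∨
      ((A (ord j)).card + (if ord j = q then 1 else 0) + (j : ℕ) ≤ n ∧ ∃ β ∈ A (ord j), β c₀ ≠ 0)) :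
    ∃ φ : Fin n → Fin n → ℂ,
      (∀ s, ∀ a ∈ A s, ∑ c, φ s c * a c = 0) ∧
      (∑ ab : Fin n × Fin n, φ p ab.1 * φ q ab.2 * g ab.1 ab.2 = 0) ∧
      (Matrix.of fun c i => φ i c).permanent ≠ 0 := by
  classical
  have hpq' : p ≠ q := fun h => by rw [h] at hpq; exact lt_irrefl _ hpq
  set z : Fin n := ⟨0, hn⟩ with hz
  set f : Fin n := ord z with hf
  have hfq : f ≠ q := by
    intro h
    have : ord.symm q = z := by rw [← h, hf, Equiv.symm_apply_apply]
    rw [this, Fin.lt_def] at hpq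
    exact Nat.not_lt_zero _ hpq
  -- INVARIANT after processing the positions `< j` (`j ≥ 1`): basis row at `f`, pivots `c m` (`c z = c₀`)
  have step : ∀ j : ℕ, 1 ≤ j → j ≤ n → ∃ (φ : Fin n → Fin n → ℂ) (c : Fin n → Fin n),
      φ f = Pi.single c₀ 1 ∧ c z = c₀ ∧
      (∀ m : Fin n, 0 < (m : ℕ) → (m : ℕ) < j →
        (∀ a ∈ A (ord m), ∑ x, φ (ord m) x * a x = 0) ∧
        (ord m = q → ∑ ab : Fin n × Fin n, φ p ab.1 * φ q ab.2 * g ab.1 ab.2 = 0) ∧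
        φ (ord m) (c m) ≠ 0 ∧
        (∀ l : Fin n, 0 < (l : ℕ) → l < m → φ (ord m) (c l) = 0)) ∧
      (∀ m m' : Fin n, (m : ℕ) < j → (m' : ℕ) < j → c m = c m' → m = m') := by
    intro j hj1 hjn
    induction j with
    | zero => exact absurd hj1 (by norm_num)
    | succ j ih =>
      rcases Nat.eq_zero_or_pos j with hj0 | hjpos
      · -- base: only the basis row
        subst hj0
        refine ⟨Function.update (fun _ _ => 0) f (Pi.single c₀ 1), fun _ => c₀, by simp, rfl, ?_, ?_⟩
        · intro m hm0 hm1; omega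
        · intro m m' hm hm' _; exact Fin.ext (by omega)
      obtain ⟨φ, c, hφf, hcz, hinv, hinj⟩ := ih hjpos (by omega)
      set jf : Fin n := ⟨j, by omega⟩ with hjf
      set s : Fin n := ord jf with hs
      have hjz : jf ≠ z := fun h => by
        have := congrArg Fin.val h; rw [hjf, hz] at this; simp at this; omega
      have hsf : s ≠ f := fun h => hjz (ord.injective (h.trans hf))
      let pairRow : Fin n → ℂ := fun b => ∑ a, φ p a * g a b
      -- the pivot-avoidance vectors of the earlier later rows
      let Piv : Finset (Fin n → ℂ) :=
        (univ.filter (fun l : Fin n => 0 < (l : ℕ) ∧ l < jf)).image (fun l => Pi.single (c l) 1)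
      have hPiv : Piv.card ≤ j - 1 := by
        have hsub : (univ.filter (fun l : Fin n => 0 < (l : ℕ) ∧ l < jf)) ⊆ (Finset.Iio jf).erase z := by
          intro l hl
          simp only [mem_filter, mem_univ, true_and] at hl
          rw [mem_erase, Finset.mem_Iio]
          refine ⟨fun h => ?_, hl.2⟩
          rw [h, hz] at hl; exact absurd hl.1 (lt_irrefl _)
        refine card_image_le.trans ((card_le_card hsub).trans ?_)
        rw [card_erase_of_mem (by rw [Finset.mem_Iio, Fin.lt_def]; exact hjpos), Fin.card_Iio]
      have hPiv_mem : ∀ l : Fin n, 0 < (l : ℕ) → l < jf → Pi.single (c l) (1 : ℂ) ∈ Piv := fun l hl0 hl => by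
        simp only [Piv, mem_image, mem_filter, mem_univ, true_and]
        exact ⟨l, ⟨hl0, hl⟩, rfl⟩
      -- the new covector and its pivot (two cases: bonus slot or not)
      obtain ⟨ψ, cj, hψA, hψq, hψc, hcj0, hcj⟩ : ∃ (ψ : Fin n → ℂ) (cj : Fin n),
          (∀ a ∈ A s, ∑ x, ψ x * a x = 0) ∧ (s = q → ∑ x, ψ x * pairRow x = 0) ∧
          (∀ l : Fin n, 0 < (l : ℕ) → l < jf → ψ (c l) = 0) ∧ cj ≠ c₀ ∧ ψ cj ≠ 0 := by
        have h2 := hcount jf (by rw [hjf]; exact hjpos)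
        have hjv : (jf : ℕ) = j := rfl
        rw [← hs, hjv] at h2
        by_cases hbonus : ∃ β ∈ A s, β c₀ ≠ 0
        · -- BONUS slot: no condition at `c₀`
          let T : Finset (Fin n → ℂ) := A s ∪ (if s = q then {pairRow} else ∅) ∪ Piv
          have hT : T.card < n := by
            have h1 : T.card ≤ (A s).card + (if s = q then 1 else 0) + (j - 1) := by
              refine (card_union_le _ _).trans ?_
              refine (Nat.add_le_add_right (card_union_le _ _) _).trans ?_
              refine Nat.add_le_add (Nat.add_le_add_left ?_ _) hPiv
              split_ifs <;> simp
            rcases h2 with h2 | ⟨h2, -⟩ <;> omega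
          obtain ⟨ψ, hψ0, hψ⟩ := exists_ne_zero_orthogonal T hT
          have hψA : ∀ a ∈ A s, ∑ x, ψ x * a x = 0 := fun a ha => hψ a (by simp [T, ha])
          have hψq : s = q → ∑ x, ψ x * pairRow x = 0 := fun hsq => hψ pairRow (by simp [T, hsq])
          have hψc : ∀ l : Fin n, 0 < (l : ℕ) → l < jf → ψ (c l) = 0 := by
            intro l hl0 hl
            have := hψ (Pi.single (c l) 1) (by simp only [T, mem_union]; exact Or.inr (hPiv_mem l hl0 hl))
            simpa [Pi.single_apply] using this
          -- a pivot off `c₀`: `ψ` is not a multiple of `e_{c₀}` because it kills a `β` with `β c₀ ≠ 0`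
          obtain ⟨cj, hcj0, hcj⟩ : ∃ x, x ≠ c₀ ∧ ψ x ≠ 0 := by
            by_contra h
            push Not at h
            obtain ⟨β, hβ, hβc⟩ := hbonus
            have hsum := hψA β hβ
            rw [Fintype.sum_eq_single c₀ (fun x hx => by rw [h x hx, zero_mul])] at hsum
            rcases mul_eq_zero.mp hsum with h1 | h1
            · apply hψ0; funext x
              by_cases hx : x = c₀
              · rw [hx, h1]; rfl
              · exact h x hx
            · exact hβc h1
          exact ⟨ψ, cj, hψA, hψq, hψc, hcj0, hcj⟩
        · -- ordinary slot: the extra condition `ψ c₀ = 0`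
          let T : Finset (Fin n → ℂ) := A s ∪ (if s = q then {pairRow} else ∅) ∪ Piv ∪ {Pi.single c₀ 1}
          have hT : T.card < n := by
            have h1 : T.card ≤ (A s).card + (if s = q then 1 else 0) + (j - 1) + 1 := by
              refine (card_union_le _ _).trans ?_
              refine Nat.add_le_add ?_ (by simp)
              refine (card_union_le _ _).trans ?_
              refine (Nat.add_le_add_right (card_union_le _ _) _).trans ?_
              refine Nat.add_le_add (Nat.add_le_add_left ?_ _) hPiv
              split_ifs <;> simp
            rcases h2 with h2 | ⟨-, hb⟩
            · omega
            · exact absurd hb hbonus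
          obtain ⟨ψ, hψ0, hψ⟩ := exists_ne_zero_orthogonal T hT
          have hψA : ∀ a ∈ A s, ∑ x, ψ x * a x = 0 := fun a ha => hψ a (by simp [T, ha])
          have hψq : s = q → ∑ x, ψ x * pairRow x = 0 := fun hsq => hψ pairRow (by simp [T, hsq])
          have hψc : ∀ l : Fin n, 0 < (l : ℕ) → l < jf → ψ (c l) = 0 := by
            intro l hl0 hl
            have := hψ (Pi.single (c l) 1) (by
              simp only [T, mem_union]; exact Or.inl (Or.inr (hPiv_mem l hl0 hl)))
            simpa [Pi.single_apply] using this
          have hψz : ψ c₀ = 0 := by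
            have := hψ (Pi.single c₀ 1) (by simp [T])
            simpa [Pi.single_apply] using this
          obtain ⟨cj, hcj0, hcj⟩ : ∃ x, x ≠ c₀ ∧ ψ x ≠ 0 := by
            by_contra h
            push Not at h
            apply hψ0; funext x
            by_cases hx : x = c₀
            · rw [hx, hψz]; rfl
            · exact h x hx
          exact ⟨ψ, cj, hψA, hψq, hψc, hcj0, hcj⟩
      -- extend
      refine ⟨Function.update φ s ψ, Function.update c jf cj, ?_, ?_, ?_, ?_⟩
      · rw [Function.update_of_ne hsf.symm]; exact hφf
      · rw [Function.update_of_ne hjz.symm]; exact hcz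
      · intro m hm0 hm
        rcases Nat.lt_succ_iff_lt_or_eq.mp hm with hm' | hm'
        · -- an earlier slot: unchanged
          have hmj : m ≠ jf := fun h => by rw [h] at hm'; exact lt_irrefl _ hm'
          have hms : ord m ≠ s := fun h => hmj (ord.injective (h.trans hs))
          obtain ⟨h1, h2, h3, h4⟩ := hinv m hm0 hm'
          refine ⟨?_, ?_, ?_, ?_⟩
          · intro a ha
            rw [Function.update_of_ne hms]
            exact h1 a ha
          · intro hmq
            have hps : p ≠ s := by
              intro h
              have e1 : ord.symm p = jf := by rw [h, hs, Equiv.symm_apply_apply]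
              have e2 : ord.symm q = m := by rw [← hmq, Equiv.symm_apply_apply]
              have := hpq
              rw [e1, e2, Fin.lt_def] at this
              exact absurd (lt_trans this hm') (lt_irrefl _)
            have hqs : q ≠ s := by rw [← hmq]; exact hms
            rw [Function.update_of_ne hps, Function.update_of_ne hqs]
            exact h2 hmq
          · rw [Function.update_of_ne hms, Function.update_of_ne hmj]
            exact h3
          · intro l hl0 hl
            have hlj : l ≠ jf := by
              intro h; rw [h, Fin.lt_def] at hl
              exact absurd (lt_trans hl hm') (lt_irrefl _)
            rw [Function.update_of_ne hms, Function.update_of_ne hlj]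
            exact h4 l hl0 hl
        · -- the new slot `m = jf`
          have hmj : m = jf := Fin.ext hm'
          have hom : ord m = s := by rw [hmj, hs]
          refine ⟨?_, ?_, ?_, ?_⟩
          · intro a ha
            rw [hom, Function.update_self]
            rw [hom] at ha
            exact hψA a ha
          · intro hq
            rw [hom] at hq
            have hps : p ≠ s := fun h => hpq' (h.trans hq)
            have hsq : Function.update φ s ψ q = ψ := by rw [← hq, Function.update_self]
            have hsp : Function.update φ s ψ p = φ p := Function.update_of_ne hps _ _
            rw [hsq, hsp, Fintype.sum_prod_type, Finset.sum_comm]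
            have := hψq hq
            simp only [pairRow] at this
            rw [← this]
            refine sum_congr rfl fun b _ => ?_
            rw [mul_sum]
            exact sum_congr rfl fun a _ => by ring
          · rw [hom, hmj, Function.update_self, Function.update_self]
            exact hcj
          · intro l hl0 hl
            have hlj : l ≠ jf := by
              intro h; rw [h, hmj] at hl; exact lt_irrefl _ hl
            rw [hom, Function.update_self, Function.update_of_ne hlj]
            exact hψc l hl0 (by rw [hmj] at hl; exact hl)
      · -- injectivity of the pivots (including `c z = c₀`)
        intro m m' hm hm' hcc
        rcases Nat.lt_succ_iff_lt_or_eq.mp hm with h1 | h1 <;> rcases Nat.lt_succ_iff_lt_or_eq.mp hm' with h2 | h2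
        · have hmj : m ≠ jf := fun h => by rw [h] at h1; exact lt_irrefl _ h1
          have hmj' : m' ≠ jf := fun h => by rw [h] at h2; exact lt_irrefl _ h2
          rw [Function.update_of_ne hmj, Function.update_of_ne hmj'] at hcc
          exact hinj m m' h1 h2 hcc
        · have hmj : m ≠ jf := fun h => by rw [h] at h1; exact lt_irrefl _ h1
          have hm'j : m' = jf := Fin.ext h2
          rw [Function.update_of_ne hmj, hm'j, Function.update_self] at hcc
          -- `c m = cj`: impossible (`m = z` gives `c₀ = cj`; `m > 0` gives `ψ (c m) = 0 ≠ ψ cj`)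
          exfalso
          rcases Nat.eq_zero_or_pos (m : ℕ) with hmz | hmpos
          · have : m = z := Fin.ext hmz
            rw [this, hcz] at hcc; exact hcj0 hcc.symm
          · have := hψc m hmpos (by rw [Fin.lt_def]; exact h1)
            rw [hcc] at this; exact hcj this
        · have hm'j : m' ≠ jf := fun h => by rw [h] at h2; exact lt_irrefl _ h2
          have hmj : m = jf := Fin.ext h1
          rw [Function.update_of_ne hm'j, hmj, Function.update_self] at hcc
          exfalso
          rcases Nat.eq_zero_or_pos (m' : ℕ) with hmz | hmpos
          · have : m' = z := Fin.ext hmz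
            rw [this, hcz] at hcc; exact hcj0 hcc
          · have := hψc m' hmpos (by rw [Fin.lt_def]; exact h2)
            rw [← hcc] at this; exact hcj this
        · exact Fin.ext (by rw [h1, h2])
  -- all `n` slots processed
  obtain ⟨φ, c, hφf, hcz, hinv, hinj⟩ := step n (by omega) le_rfl
  have hcinj : Function.Injective c := fun m m' h => hinj m m' m.isLt m'.isLt h
  let cperm : Equiv.Perm (Fin n) := Equiv.ofBijective c (Finite.injective_iff_bijective.mp hcinj)
  have hmpos : ∀ s : Fin n, s ≠ f → 0 < (ord.symm s : ℕ) := by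
    intro s hs
    rcases Nat.eq_zero_or_pos (ord.symm s : ℕ) with h | h
    · exfalso; apply hs
      have : ord.symm s = z := Fin.ext h
      rw [hf, ← this, Equiv.apply_symm_apply]
    · exact h
  refine ⟨φ, ?_, ?_, ?_⟩
  · intro s a ha
    by_cases hs : s = f
    · rw [hs, hf] at ha; rw [hA0] at ha; exact absurd ha (by simp)
    · have := (hinv (ord.symm s) (hmpos s hs) (ord.symm s).isLt).1 a (by simpa using ha)
      simpa using this
  · exact (hinv (ord.symm q) (hmpos q hfq.symm) (ord.symm q).isLt).2.1 (by simp)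
  · rw [permanent_eq_prod_of_triangular_basis φ (ord.symm.trans cperm) (fun i => (ord.symm i : ℕ))
      (fun i i' h => ord.symm.injective (Fin.ext h)) f ?_ ?_]
    · refine prod_ne_zero_iff.mpr fun i _ => ?_
      by_cases hi : i = f
      · subst hi
        have : (ord.symm.trans cperm) (ord z) = c₀ := by simp [cperm, hcz]
        rw [← hf] at this
        rw [this, hφf]; simp
      · have := (hinv (ord.symm i) (hmpos i hi) (ord.symm i).isLt).2.2.1
        simpa [cperm] using this
    · intro x hx
      have : (ord.symm.trans cperm) f = c₀ := by simp [cperm, hf, hcz]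
      rw [this] at hx
      rw [hφf]; simp [hx]
    · intro i i' hi hi' hlt
      have := (hinv (ord.symm i) (hmpos i hi) (ord.symm i).isLt).2.2.2 (ord.symm i') (hmpos i' hi')
        (by rw [Fin.lt_def]; exact hlt)
      simpa [cperm] using this

end LaplaceTriangular

end Summit.ValiantsHypothesis.ValiantsHypothesis.Theorems.RigidityForcesSymmetryRankRigidMinimalRepr
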